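/-
Lead `ym-line-sgb-p2` (gen 1, seat prover-ym-line-sgb-p2-g1-0), route `SteinGapBootstrap`, crux item
stmt-QuantumFields-23800 `UProbeCovFromPairLaw` ≡ stmt-QuantumFields-23640 `ProbeCovFromPairLawG`, line `direct`,
STUB `stub_gaussTest` (the Gaussian test functions have bounded `C²` norms, uniformly in the block).
-/
import Mathlib
import Literature.MathematicalPhysics.QuantumLattice.LatticeGaugeDLR
import HarnessLib

/-!
# Route `SteinGapBootstrap`, crux `UProbeCovFromPairLaw` (stmt-QuantumFields-23800 ≡ `ProbeCovFromPairLawG` 23640),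
# line `direct`: STUB `stub_gaussTest` — `C²` bounds for the Gaussian test functions

NOT THE CLAY GAP: the route bears on the RECORD-label rung leaf R2ξ′ `WeakCouplingRates.XiPow`; this file is elementary
calculus and proves no summit statement.

For a real normed space `E`, finitely many continuous linear functionals `ℓ_i` of norm `≤ 1` and
`F(z) = exp(−Σ_i ℓ_i(z)²)`: `F` is smooth, `‖DF(z)‖ ≤ 2(c + 1)` and `‖D²F(z)‖ ≤ 16c + 4(c + 1)²`, `c = #ι`
(`GaussTest.bounds`; Faà di Bruno bound `norm_iteratedFDeriv_comp_le` for `exp(−·) ∘ q`, `q = Σ ℓ_i²`, with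
`‖Dq(z)‖ ≤ 2Σ|ℓ_i z|`, `‖D²q‖ ≤ 2c`, and `(Σ|ℓ_i z|)² ≤ c q(z)`, `q e^{−q} ≤ 1`). Specialised to the coordinate
functionals `z ↦ z_p^a` of the block space `↥B → Fin D → ℝ` this is the registered stub `stub_gaussTest`: the test
functions `z ↦ e^{−|z_p|²}` and `z ↦ e^{−|z_p|²} e^{−|z_q|²}` have `C²` norms bounded by a constant depending only on `D`.

References: E. Meckes, IMS Collections 5 (2009) 153–178, §1 (the smooth test class) [Meckes2009].
-/

set_option autoImplicit false

noncomputable section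

namespace Summit.QuantumFields.YangMills.Theorems.SteinGapBootstrap

namespace ProbeCovDirect

namespace GaussTest

open Real

/-! ### One-dimensional facts -/

/-- `(s²)' = 2s` as functions. [folklore] -/
theorem deriv_sq : deriv (fun s : ℝ => s ^ 2) = fun s => 2 * s := by
  funext s
  simp

/-- `iteratedDeriv 1 (s ↦ s²) t = 2t`. [folklore] -/
theorem iteratedDeriv_one_sq (t : ℝ) : iteratedDeriv 1 (fun s : ℝ => s ^ 2) t = 2 * t := by
  rw [iteratedDeriv_one, deriv_sq]

/-- `iteratedDeriv 2 (s ↦ s²) t = 2`. [folklore] -/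
theorem iteratedDeriv_two_sq (t : ℝ) : iteratedDeriv 2 (fun s : ℝ => s ^ 2) t = 2 := by
  rw [iteratedDeriv_succ, iteratedDeriv_one, deriv_sq]
  have h : HasDerivAt (fun s : ℝ => 2 * s) 2 t := by
    simpa using (hasDerivAt_id t).const_mul (2 : ℝ)
  exact h.deriv

/-- `s ↦ s²` is smooth. [folklore] -/
theorem contDiff_sq {n : WithTop ℕ∞} : ContDiff ℝ n (fun s : ℝ => s ^ 2) := contDiff_id.pow 2

/-- `s ↦ e^{−s}` is smooth. [folklore] -/
theorem contDiff_expNeg {n : WithTop ℕ∞} : ContDiff ℝ n (fun s : ℝ => Real.exp (-s)) :=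
  Real.contDiff_exp.comp contDiff_neg

/-- All derivatives of `s ↦ e^{−s}` have absolute value `e^{−s}`. [folklore] -/
theorem norm_iteratedFDeriv_expNeg (k : ℕ) (s : ℝ) :
    ‖iteratedFDeriv ℝ k (fun s : ℝ => Real.exp (-s)) s‖ = Real.exp (-s) := by
  rw [norm_iteratedFDeriv_eq_norm_iteratedDeriv, iteratedDeriv_comp_neg k Real.exp s,
    iteratedDeriv_eq_iterate, Real.iter_deriv_exp, norm_smul, norm_pow, norm_neg, norm_one, one_pow, one_mul,
    Real.norm_eq_abs, abs_of_pos (Real.exp_pos _)]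

/-! ### The quadratic form `q = Σ ℓ_i²` -/

variable {E : Type*} [NormedAddCommGroup E] [NormedSpace ℝ E]

/-- First derivative of `z ↦ ℓ(z)²`: norm `≤ 2|ℓ z|` for `‖ℓ‖ ≤ 1`. [folklore] -/
theorem norm_iteratedFDeriv_one_sq_comp (ℓ : E →L[ℝ] ℝ) (hℓ : ‖ℓ‖ ≤ 1) (z : E) :
    ‖iteratedFDeriv ℝ 1 (fun z => (ℓ z) ^ 2) z‖ ≤ 2 * |ℓ z| := by
  have h := ℓ.iteratedFDeriv_comp_right (f := fun s : ℝ => s ^ 2) (contDiff_sq (n := 1)) z (i := 1) le_rfl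
  rw [show (fun z => (ℓ z) ^ 2) = (fun s : ℝ => s ^ 2) ∘ ℓ from rfl, h]
  refine (ContinuousMultilinearMap.norm_compContinuousLinearMap_le _ _).trans ?_
  rw [norm_iteratedFDeriv_eq_norm_iteratedDeriv, iteratedDeriv_one_sq, Real.norm_eq_abs, abs_mul, abs_two]
  refine mul_le_of_le_one_right (by positivity) ?_
  exact Finset.prod_le_one (fun _ _ => norm_nonneg _) fun _ _ => hℓ

/-- Second derivative of `z ↦ ℓ(z)²`: norm `≤ 2` for `‖ℓ‖ ≤ 1`. [folklore] -/
theorem norm_iteratedFDeriv_two_sq_comp (ℓ : E →L[ℝ] ℝ) (hℓ : ‖ℓ‖ ≤ 1) (z : E) :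
    ‖iteratedFDeriv ℝ 2 (fun z => (ℓ z) ^ 2) z‖ ≤ 2 := by
  have h := ℓ.iteratedFDeriv_comp_right (f := fun s : ℝ => s ^ 2) (contDiff_sq (n := 2)) z (i := 2) le_rfl
  rw [show (fun z => (ℓ z) ^ 2) = (fun s : ℝ => s ^ 2) ∘ ℓ from rfl, h]
  refine (ContinuousMultilinearMap.norm_compContinuousLinearMap_le _ _).trans ?_
  rw [norm_iteratedFDeriv_eq_norm_iteratedDeriv, iteratedDeriv_two_sq, Real.norm_eq_abs, abs_two]
  refine mul_le_of_le_one_right (by positivity) ?_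
  exact Finset.prod_le_one (fun _ _ => norm_nonneg _) fun _ _ => hℓ

variable {ι : Type*} [Fintype ι]

/-- `q = Σ_i ℓ_i²` is smooth. [folklore] -/
theorem contDiff_sumSq {n : WithTop ℕ∞} (ℓ : ι → E →L[ℝ] ℝ) :
    ContDiff ℝ n (fun z => ∑ i, (ℓ i z) ^ 2) :=
  ContDiff.sum fun i _ => (ℓ i).contDiff.pow 2

/-- `‖Dq(z)‖ ≤ 2 Σ_i |ℓ_i z|`. [folklore] -/
theorem norm_iteratedFDeriv_one_sumSq (ℓ : ι → E →L[ℝ] ℝ) (hℓ : ∀ i, ‖ℓ i‖ ≤ 1) (z : E) :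
    ‖iteratedFDeriv ℝ 1 (fun z => ∑ i, (ℓ i z) ^ 2) z‖ ≤ 2 * ∑ i, |ℓ i z| := by
  rw [iteratedFDeriv_fun_sum_apply fun i _ => (((ℓ i).contDiff (n := 1)).pow 2).contDiffAt, Finset.mul_sum]
  exact (norm_sum_le _ _).trans (Finset.sum_le_sum fun i _ => norm_iteratedFDeriv_one_sq_comp (ℓ i) (hℓ i) z)

/-- `‖D²q(z)‖ ≤ 2 #ι`. [folklore] -/
theorem norm_iteratedFDeriv_two_sumSq (ℓ : ι → E →L[ℝ] ℝ) (hℓ : ∀ i, ‖ℓ i‖ ≤ 1) (z : E) :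
    ‖iteratedFDeriv ℝ 2 (fun z => ∑ i, (ℓ i z) ^ 2) z‖ ≤ 2 * Fintype.card ι := by
  rw [iteratedFDeriv_fun_sum_apply fun i _ => (((ℓ i).contDiff (n := 2)).pow 2).contDiffAt]
  refine (norm_sum_le _ _).trans ((Finset.sum_le_sum fun i _ => norm_iteratedFDeriv_two_sq_comp (ℓ i) (hℓ i) z).trans ?_)
  rw [Finset.sum_const, Finset.card_univ, nsmul_eq_mul, mul_comm]

/-- Cauchy–Schwarz: `(Σ_i |ℓ_i z|)² ≤ #ι · Σ_i ℓ_i(z)²`. [folklore] -/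
theorem sq_sum_abs_le (ℓ : ι → E →L[ℝ] ℝ) (z : E) :
    (∑ i, |ℓ i z|) ^ 2 ≤ (Fintype.card ι : ℝ) * ∑ i, (ℓ i z) ^ 2 := by
  have h := sq_sum_le_card_mul_sum_sq (s := Finset.univ) (f := fun i => |ℓ i z|)
  simp only [sq_abs, Finset.card_univ] at h
  exact h

/-! ### The Gaussian test function `F = exp(−q)` -/

/-- **`C²` bounds for `F(z) = exp(−Σ_i ℓ_i(z)²)`** with `‖ℓ_i‖ ≤ 1`: `F` is smooth, `‖DF(z)‖ ≤ 2(#ι + 1)` and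
`‖D²F(z)‖ ≤ 16 #ι + 4(#ι + 1)²` for every `z`. [folklore] -/
theorem bounds (ℓ : ι → E →L[ℝ] ℝ) (hℓ : ∀ i, ‖ℓ i‖ ≤ 1) :
    ContDiff ℝ (⊤ : ℕ∞) (fun z => Real.exp (-(∑ i, (ℓ i z) ^ 2))) ∧
      ∀ z, ‖fderiv ℝ (fun z => Real.exp (-(∑ i, (ℓ i z) ^ 2))) z‖ ≤ 2 * (Fintype.card ι + 1) ∧
        ‖iteratedFDeriv ℝ 2 (fun z => Real.exp (-(∑ i, (ℓ i z) ^ 2))) z‖ ≤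
          16 * Fintype.card ι + 4 * (Fintype.card ι + 1) ^ 2 := by
  have hF : (fun z => Real.exp (-(∑ i, (ℓ i z) ^ 2))) = (fun s : ℝ => Real.exp (-s)) ∘ (fun z => ∑ i, (ℓ i z) ^ 2) :=
    rfl
  refine ⟨?_, fun z => ?_⟩
  · rw [hF]; exact contDiff_expNeg.comp (contDiff_sumSq ℓ)
  set c : ℝ := (Fintype.card ι : ℝ) with hc
  set S : ℝ := ∑ i, |ℓ i z| with hS
  set Q : ℝ := ∑ i, (ℓ i z) ^ 2 with hQ
  have hc0 : 0 ≤ c := by positivity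
  have hS0 : 0 ≤ S := Finset.sum_nonneg fun i _ => abs_nonneg _
  have hQ0 : 0 ≤ Q := Finset.sum_nonneg fun i _ => sq_nonneg _
  have hSQ : S ^ 2 ≤ c * Q := sq_sum_abs_le ℓ z
  have hQe : Q * Real.exp (-Q) ≤ 1 := by
    -- `x e^{-x} ≤ 1` (tree: `Literature.NumberTheory.Automorphic.SelbergDecay.mul_exp_neg_le_one`, not imported here)
    have h1 : Q + 1 ≤ Real.exp Q := Real.add_one_le_exp Q
    have h2 : Real.exp (-Q) * Real.exp Q = 1 := by rw [← Real.exp_add, neg_add_cancel, Real.exp_zero]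
    nlinarith [Real.exp_pos (-Q), Real.exp_pos Q]
  have he1 : Real.exp (-Q) ≤ 1 := Real.exp_le_one_iff.2 (by linarith)
  have he0 : 0 < Real.exp (-Q) := Real.exp_pos _
  -- the Faà di Bruno data
  set Dz : ℝ := 2 * S + c + 1 with hDz
  have hDz0 : 0 ≤ Dz := by positivity
  have hC : ∀ (n i : ℕ), i ≤ n →
      ‖iteratedFDeriv ℝ i (fun s : ℝ => Real.exp (-s)) ((fun z => ∑ i, (ℓ i z) ^ 2) z)‖ ≤ Real.exp (-Q) :=
    fun n i _ => (norm_iteratedFDeriv_expNeg i _).le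
  have hD : ∀ i : ℕ, 1 ≤ i → i ≤ 2 → ‖iteratedFDeriv ℝ i (fun z => ∑ i, (ℓ i z) ^ 2) z‖ ≤ Dz ^ i := by
    intro i hi1 hi2
    interval_cases i
    · rw [pow_one]
      exact (norm_iteratedFDeriv_one_sumSq ℓ hℓ z).trans (by rw [hDz]; linarith)
    · refine (norm_iteratedFDeriv_two_sumSq ℓ hℓ z).trans ?_
      rw [hDz]; nlinarith
  constructor
  · -- first derivative
    have h1 := norm_iteratedFDeriv_comp_le (n := 1) (contDiff_expNeg (n := 1)) (contDiff_sumSq (n := 1) ℓ) le_rfl z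
      (hC 1) (fun i hi1 hi2 => hD i hi1 (hi2.trans one_le_two))
    rw [← hF, Nat.factorial_one, Nat.cast_one, one_mul, pow_one] at h1
    have e : ‖fderiv ℝ (fun z => Real.exp (-(∑ i, (ℓ i z) ^ 2))) z‖ =
        ‖iteratedFDeriv ℝ 1 (fun z => Real.exp (-(∑ i, (ℓ i z) ^ 2))) z‖ := by
      rw [← norm_iteratedFDeriv_fderiv, norm_iteratedFDeriv_zero]
    rw [e]
    refine h1.trans ?_
    have h2S : 2 * S ≤ c * Q + 1 := by nlinarith [sq_nonneg (S - 1)]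
    have hcQ : c * (Q * Real.exp (-Q)) ≤ c * 1 := mul_le_mul_of_nonneg_left hQe hc0
    calc Real.exp (-Q) * Dz = Real.exp (-Q) * (2 * S) + (c + 1) * Real.exp (-Q) := by rw [hDz]; ring
      _ ≤ Real.exp (-Q) * (c * Q + 1) + (c + 1) * 1 :=
          add_le_add (mul_le_mul_of_nonneg_left h2S he0.le) (mul_le_mul_of_nonneg_left he1 (by positivity))
      _ = c * (Q * Real.exp (-Q)) + Real.exp (-Q) + (c + 1) := by ring
      _ ≤ c * 1 + 1 + (c + 1) := by linarith
      _ = 2 * (c + 1) := by ring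
  · -- second derivative
    have h2 := norm_iteratedFDeriv_comp_le (n := 2) (contDiff_expNeg (n := 2)) (contDiff_sumSq (n := 2) ℓ) le_rfl z
      (hC 2) hD
    rw [← hF, Nat.factorial_two, Nat.cast_ofNat] at h2
    refine h2.trans ?_
    have hDz2 : Dz ^ 2 ≤ 8 * (c * Q) + 2 * (c + 1) ^ 2 := by
      rw [hDz]; nlinarith [sq_nonneg (2 * S - (c + 1))]
    have hcQ : c * (Q * Real.exp (-Q)) ≤ c * 1 := mul_le_mul_of_nonneg_left hQe hc0
    have hce : (c + 1) ^ 2 * Real.exp (-Q) ≤ (c + 1) ^ 2 * 1 := mul_le_mul_of_nonneg_left he1 (sq_nonneg _)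
    calc 2 * Real.exp (-Q) * Dz ^ 2 ≤ 2 * Real.exp (-Q) * (8 * (c * Q) + 2 * (c + 1) ^ 2) :=
          mul_le_mul_of_nonneg_left hDz2 (by positivity)
      _ = 16 * (c * (Q * Real.exp (-Q))) + 4 * ((c + 1) ^ 2 * Real.exp (-Q)) := by ring
      _ ≤ 16 * (c * 1) + 4 * ((c + 1) ^ 2 * 1) := by linarith
      _ = 16 * c + 4 * (c + 1) ^ 2 := by ring

end GaussTest

open GaussTest in
/-- STUB `stub_gaussTest` of line `direct` (crux stmt-QuantumFields-23800 ≡ 23640) — **the Gaussian test functions have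
bounded `C²` norms, uniformly in the block**: for every `D` there is `L > 0` such that for every finite block `B` of
plaquettes and `p, q ∈ B` the functions `z ↦ exp(−Σ_a (z_p^a)²)` and `z ↦ exp(−Σ_a (z_p^a)²) exp(−Σ_a (z_q^a)²)` on
`↥B → Fin D → ℝ` are smooth with `‖∇h‖ ≤ L`, `‖∇²h‖ ≤ L` everywhere (`GaussTest.bounds` for the coordinate functionals,
`L = 32D + 4(2D+1)² + 2(2D+1) + 1`). -/
theorem stub_gaussTest :
    ∀ (D : ℕ), ∃ L : ℝ, 0 < L ∧
      ∀ (B : Finset (Literature.MathematicalPhysics.QuantumLattice.ZdPlaquette 4)) (p q : ↥B),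
        (ContDiff ℝ (⊤ : ℕ∞) (fun z : ↥B → Fin D → ℝ => Real.exp (-(∑ a : Fin D, (z p a) ^ 2))) ∧
          ∀ z : ↥B → Fin D → ℝ,
            ‖fderiv ℝ (fun z : ↥B → Fin D → ℝ => Real.exp (-(∑ a : Fin D, (z p a) ^ 2))) z‖ ≤ L ∧
            ‖iteratedFDeriv ℝ 2 (fun z : ↥B → Fin D → ℝ => Real.exp (-(∑ a : Fin D, (z p a) ^ 2))) z‖ ≤ L) ∧
        (ContDiff ℝ (⊤ : ℕ∞) (fun z : ↥B → Fin D → ℝ =>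
            Real.exp (-(∑ a : Fin D, (z p a) ^ 2)) * Real.exp (-(∑ a : Fin D, (z q a) ^ 2))) ∧
          ∀ z : ↥B → Fin D → ℝ,
            ‖fderiv ℝ (fun z : ↥B → Fin D → ℝ =>
                Real.exp (-(∑ a : Fin D, (z p a) ^ 2)) * Real.exp (-(∑ a : Fin D, (z q a) ^ 2))) z‖ ≤ L ∧
            ‖iteratedFDeriv ℝ 2 (fun z : ↥B → Fin D → ℝ =>
                Real.exp (-(∑ a : Fin D, (z p a) ^ 2)) * Real.exp (-(∑ a : Fin D, (z q a) ^ 2))) z‖ ≤ L) := by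
  intro D
  set L : ℝ := 32 * D + 4 * (2 * D + 1) ^ 2 + 2 * (2 * D + 1) + 1 with hL
  have hD0 : (0 : ℝ) ≤ D := by positivity
  refine ⟨L, by positivity, fun B p q => ?_⟩
  -- the coordinate functionals
  have hproj : ∀ (p' : ↥B) (a : Fin D),
      ‖(ContinuousLinearMap.proj (R := ℝ) a : (Fin D → ℝ) →L[ℝ] ℝ).comp
        (ContinuousLinearMap.proj (R := ℝ) p' : (↥B → Fin D → ℝ) →L[ℝ] (Fin D → ℝ))‖ ≤ 1 := by
    intro p' a
    refine ContinuousLinearMap.opNorm_le_bound _ zero_le_one fun z => ?_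
    rw [one_mul]
    exact (norm_le_pi_norm (z p') a).trans (norm_le_pi_norm z p')
  set ℓ₁ : Fin D → (↥B → Fin D → ℝ) →L[ℝ] ℝ := fun a =>
    (ContinuousLinearMap.proj (R := ℝ) a : (Fin D → ℝ) →L[ℝ] ℝ).comp
      (ContinuousLinearMap.proj (R := ℝ) p : (↥B → Fin D → ℝ) →L[ℝ] (Fin D → ℝ)) with hℓ₁
  set ℓ₂ : Fin D ⊕ Fin D → (↥B → Fin D → ℝ) →L[ℝ] ℝ := Sum.elim
    (fun a => (ContinuousLinearMap.proj (R := ℝ) a : (Fin D → ℝ) →L[ℝ] ℝ).comp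
      (ContinuousLinearMap.proj (R := ℝ) p : (↥B → Fin D → ℝ) →L[ℝ] (Fin D → ℝ)))
    (fun a => (ContinuousLinearMap.proj (R := ℝ) a : (Fin D → ℝ) →L[ℝ] ℝ).comp
      (ContinuousLinearMap.proj (R := ℝ) q : (↥B → Fin D → ℝ) →L[ℝ] (Fin D → ℝ))) with hℓ₂
  have hℓ₁n : ∀ a, ‖ℓ₁ a‖ ≤ 1 := fun a => hproj p a
  have hℓ₂n : ∀ i, ‖ℓ₂ i‖ ≤ 1 := by
    rintro (a | a)
    · exact hproj p a
    · exact hproj q a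
  have hf1 : (fun z : ↥B → Fin D → ℝ => Real.exp (-(∑ a : Fin D, (z p a) ^ 2))) =
      fun z => Real.exp (-(∑ a, (ℓ₁ a z) ^ 2)) := rfl
  have hf2 : (fun z : ↥B → Fin D → ℝ =>
      Real.exp (-(∑ a : Fin D, (z p a) ^ 2)) * Real.exp (-(∑ a : Fin D, (z q a) ^ 2))) =
      fun z => Real.exp (-(∑ i, (ℓ₂ i z) ^ 2)) := by
    funext z
    rw [← Real.exp_add, ← neg_add, Fintype.sum_sum_type]
    rfl
  obtain ⟨h1s, h1b⟩ := bounds ℓ₁ hℓ₁n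
  obtain ⟨h2s, h2b⟩ := bounds ℓ₂ hℓ₂n
  have hc1 : (Fintype.card (Fin D) : ℝ) = D := by rw [Fintype.card_fin]
  have hc2 : (Fintype.card (Fin D ⊕ Fin D) : ℝ) = 2 * D := by
    rw [Fintype.card_sum, Fintype.card_fin]; push_cast; ring
  refine ⟨⟨by rw [hf1]; exact h1s, fun z => ?_⟩, ⟨by rw [hf2]; exact h2s, fun z => ?_⟩⟩
  · obtain ⟨hb1, hb2⟩ := h1b z
    rw [hc1] at hb1 hb2
    rw [hf1]
    exact ⟨hb1.trans (by rw [hL]; nlinarith), hb2.trans (by rw [hL]; nlinarith)⟩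
  · obtain ⟨hb1, hb2⟩ := h2b z
    rw [hc2] at hb1 hb2
    rw [hf2]
    exact ⟨hb1.trans (by rw [hL]; nlinarith), hb2.trans (by rw [hL]; nlinarith)⟩

end ProbeCovDirect

end Summit.QuantumFields.YangMills.Theorems.SteinGapBootstrap

end
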